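import Summits.ResolutionOfSingularities.ResolutionOfSingularities.Theorems.HilbertSamuelEliminationSigmaMaxModificationsCorridor3WLadderMovingIsoLowQ
import Literature.AlgebraicGeometry.CossartJannsenSaito2020.KeyTheoremsLocal
import HarnessLib

/-!
# [OURS · L1 W4.2] SEGMENT EXTRACTION («U-seg»), DEFINITIONS: the units-half extraction in the UNIT-WISE LOCALISED model (b)
# (crux `SigmaMaxModifications` stmt-ResolutionOfSingularities-18506; conjunct `SigmaMaxModificationsCorridor3` stmt-…-19249; line `w_ladder` v6;
# plan-1 RULINGS v3.10-1 (A): «UNITS MODEL OF RECORD = (b) unit-wise LOCALIZED chains; type `UnitTowerExtractionLocQM p`»)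

Stub worker res-L1-w42-stub-1 (gen 3). Definitions-only companion of `…Corridor3WLadderSegments` (the assembly and, later, the
extraction). ONE row functional, typed ONCE over an origin predicate `Q` (regime-free) and instantiated at the (F1) regime:

* `Moving.UnitTowerExtractionLocAtQM p Q` — **the bridge proper in model (b)**: from a maximal origin of characteristic `p` at level `3`
  satisfying `Q`, every MOVING chain of canonical near steps of grade `ē ≤ 2` that is ISOLATED in the Hilbert–Samuel locus infinitely
  often, with `(e, ē) = (2, 2)` at every isolated stage, yields a chain of fundamental units LOCALISED UNIT BY UNIT
  (`IsLocalizedChainOfFundamentalUnits`, `KeyTheoremsLocal.lean`: towers `T i` over the local schemes `Spec 𝒪_{X_{n_i},x_{n_i}}` of the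
  unit starts, linked by `IsLocalSchemeAt`) in the key setting, with the characteristic hypothesis (F1) at the first initial point and
  every initial point isolated in the Hilbert–Samuel locus of its (local) initial stage — exactly the antecedents of the admissible
  F-key `KeyTheorem640_char_localized_isolated` (F-04c). Same hypotheses as the module's `UnitTowerExtractionQM p` (model (a′), ONE
  tower); only the conclusion changes.
* `Moving.UnitTowerExtractionLocQM p := UnitTowerExtractionLocAtQM p (QCharRegime p)` — the (F1)-regime instance consumed by
  `stub_Wlow3M_char` (assembly `Moving.wlow3CharM_assembledLocQ`, companion file).

OURS nodes (cf. CJS LNM 2270 Def. 6.34/6.38/6.39, p. 107 «the claims on … chains of fundamental units depend only on the localization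
`X_x = Spec(𝒪_{X,x})`»); NOT statements of the manuscript [Hironaka2017] nor of [CossartJannsenSaito2020]; not asserted. AI-written;
AI review is weaker than expert review.

References: V. Cossart, U. Jannsen, S. Saito, LNM 2270 (2020), Def. 6.34, Def. 6.38, Def. 6.39, Thm. 6.40, p. 107 [CossartJannsenSaito2020].
-/

noncomputable section

set_option linter.dupNamespace false -- mandated namespace of this single-conjunct summit

open CategoryTheory AlgebraicGeometry TopologicalSpace

namespace Summit.ResolutionOfSingularities.ResolutionOfSingularities.Theorems.SigmaMaxModificationsCorridor3.Moving

open Literature.AlgebraicGeometry.Resolution Literature.RingTheory.HilbertSamuel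
open Literature.AlgebraicGeometry.CossartJannsenSaito2020
open Summit.ResolutionOfSingularities.ResolutionOfSingularities.Theorems.CampaignW42
open Summit.ResolutionOfSingularities.ResolutionOfSingularities.Theorems.SigmaMaxModificationsCorridor3.Helpers

/-- [OURS · L1 W4.2] **THE UNIT-TOWER EXTRACTION IN MODEL (b), over an origin predicate `Q`** (regime-free): from a maximal origin of
characteristic `p` at level `3` satisfying `Q`, a MOVING chain of canonical near steps of grade `ē ≤ 2`, isolated in the
Hilbert–Samuel locus infinitely often and with `(e, ē) = (2, 2)` at every isolated stage, yields towers `T i`, lengths `len i`,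
initial points `pt i` and terminal points `tpt i` forming a chain of fundamental units localised unit by unit
(`IsLocalizedChainOfFundamentalUnits T 3 len pt tpt`) with `KeySetting (T 0) 3`, `CharHypothesis ((T 0).X 0) (pt 0)` and every `pt i`
isolated in the Hilbert–Samuel locus of `(T i).X 0`. [cite: CossartJannsenSaito2020, Def. 6.38, Def. 6.39, p. 107] -/
def UnitTowerExtractionLocAtQM (p : ℕ) (Q : ℕ → (ℕ → ℕ) → ∀ X : Scheme.{0}, X → Prop) : Prop :=
  ∀ (R : ∀ S : Scheme.{0}, CentreSeq S → Prop), OracleFunctional R → OracleAdmissible R →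
  ∀ (ν : ℕ → ℕ) (X : Scheme.{0}) [IsLocallyNoetherian X] (x : X), IsMaximalOrigin p 3 ν X x → Q 3 ν X x →
  ∀ c : ℕ → MarkedStage.{0}, Reaches R 3 ν (MarkedStage.init X x) (c 0) →
    (∀ n, CanonicalNearStep R 3 ν (c n) (c (n + 1))) → (∀ n, (c n).geomDirDim ≤ 2) →
    (∀ n, ∃ m, n ≤ m ∧ (c m).IsBlownUp R 3 ν) → (∀ n, ∃ m, n ≤ m ∧ Iso 3 (c m)) →
    (∀ n, Iso 3 (c n) → dirDim (c n) = 2 ∧ (c n).geomDirDim = 2) →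
    ∃ (T : ℕ → BlowupTower.{0}) (len : ℕ → ℕ) (pt : ∀ i, (T i).X 0) (tpt : ∀ i, (T i).X (len i)),
      IsLocalizedChainOfFundamentalUnits T 3 len pt tpt ∧ KeySetting (T 0) 3 ∧ CharHypothesis ((T 0).X 0) (pt 0) ∧
      ∀ i, @IsIsolatedInHSMaxLocus ((T i).X 0) ((T i).ln 0) 3 (pt i)

/-- [OURS · L1 W4.2] **The (F1)-regime instance** consumed by `stub_Wlow3M_char` (`Moving.wlow3CharM_assembledLocQ`): the extraction in
model (b) from origins in `QCharRegime p` («`3 ≤ p ∨ dim X ≤ 2`»). [cite: CossartJannsenSaito2020, Def. 6.39, Thm. 6.40, p. 107] -/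
def UnitTowerExtractionLocQM (p : ℕ) : Prop :=
  UnitTowerExtractionLocAtQM p (QCharRegime p)

end Summit.ResolutionOfSingularities.ResolutionOfSingularities.Theorems.SigmaMaxModificationsCorridor3.Moving

end
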